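import Summits.Langlands.Langlands.Theses.QuarterDeficit1951
import Literature.NumberTheory.GaloisRepresentations.GaloisRepUnramifiedProofs
import Literature.NumberTheory.GaloisRepresentations.TateUnramifiedLiftingHolds
import Literature.NumberTheory.GaloisRepresentations.DirichletCharacterOfGaloisCharacter
import Literature.FieldTheory.AlgClosed.PadicAlgClEquivComplex
import Literature.NumberTheory.Automorphic.BCDTTheoremBWildAtThreeDet
import Literature.NumberTheory.GaloisRepresentations.ArtinRestriction

/-!
# Route `QuarterDeficit1951` (Langlands) — crux `IcosahedralSupply`: stub `stub_irreducible`

Finite image with non-abelian projective image forces irreducibility of a two-dimensional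
Galois representation over a field of characteristic `0`.  This is a direct application of the
tree lemma `Literature.NumberTheory.GaloisRepresentations.isIrreducible_of_not_isCyclicType`
(non-cyclic finite projective image ⇒ irreducible): two non-commuting elements of the projective
image show that it is not cyclic.
-/

set_option linter.dupNamespace false

noncomputable section

open scoped NumberField MatrixGroups
open Field IsDedekindDomain Polynomial
open Literature.NumberTheory.GaloisRepresentations Literature.NumberTheory.PAdicHodge

namespace Summit.Langlands.Langlands.Theorems.QuarterDeficit1951

/-- **Stub (irreducibility).** A continuous `ρ : Γ_ℚ → GL₂(k)` (`k` a field of characteristic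
`0`) with finite image whose projective image is non-abelian is irreducible: an invariant line would
make the image upper triangular, its commutator subgroup unipotent of finite order, hence trivial in
characteristic `0`, so the projective image would be abelian. [folklore] -/
theorem stub_irreducible (k : Type) [Field k] [CharZero k] [TopologicalSpace k]
    [IsTopologicalRing k] (ρ : FramedGaloisRep ℚ k 2) (hfin : (Set.range ρ).Finite)
    (hnab : ∃ a b : absoluteGaloisGroup ℚ,
      Matrix.ProjGenLinGroup.mk (ρ a) * Matrix.ProjGenLinGroup.mk (ρ b) ≠
        Matrix.ProjGenLinGroup.mk (ρ b) * Matrix.ProjGenLinGroup.mk (ρ a)) :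
    ρ.toGaloisRep.IsIrreducible := by
  -- the image `ρ(Γ_ℚ)` is a finite subgroup of `GL₂(k)`
  haveI : Finite ρ.toMonoidHom.range := by
    have h : (Set.range ρ.toMonoidHom).Finite := hfin
    exact h.to_subtype
  -- two non-commuting elements of the projective image: it is not cyclic
  have hnc : ¬ IsCyclicType ρ.toMonoidHom := by
    intro hc
    obtain ⟨a, b, hab⟩ := hnab
    haveI : IsCyclic (projectiveImage ρ.toMonoidHom) := hc
    have ha : Matrix.ProjGenLinGroup.mk (ρ a) ∈ projectiveImage ρ.toMonoidHom := ⟨a, rfl⟩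
    have hb : Matrix.ProjGenLinGroup.mk (ρ b) ∈ projectiveImage ρ.toMonoidHom := ⟨b, rfl⟩
    letI : CommGroup (projectiveImage ρ.toMonoidHom) := IsCyclic.commGroup
    have hcomm := mul_comm (⟨_, ha⟩ : projectiveImage ρ.toMonoidHom) ⟨_, hb⟩
    exact hab (congrArg Subtype.val hcomm)
  -- non-cyclic finite projective image ⇒ irreducible
  exact isIrreducible_of_not_isCyclicType ρ.toMonoidHom hnc

end Summit.Langlands.Langlands.Theorems.QuarterDeficit1951

end
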